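import Literature.AlgebraicGeometry.Resolution.LogRegularResolution
import Mathlib.LinearAlgebra.FreeModule.PID
import Mathlib.LinearAlgebra.Dimension.RankNullity
import Mathlib.LinearAlgebra.Dimension.Localization
import Mathlib.RingTheory.Finiteness.Basic
import Mathlib.Algebra.Module.Projective
import HarnessLib

/-!
# Faces of fs monoids in `ℤⁿ`: the splitting `P_F = F^{gp} ⊕ P̄` (Kato 1994, (5.x), proof of (3.2))

`Literature/AlgebraicGeometry/Resolution/LogChartFaceSplitting.lean`. K. Kato, *Toric
singularities*, Amer. J. Math. 116 (1994): in the proof of the structure theorem (3.2) and of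
(10.3) one "may assume `φ⁻¹(𝒪^×_{X,x}) = P^×`", i.e. replace the fs monoid `P ⊆ ℤⁿ` of a chart by
the sharp monoid `P̄ = P_F/F^{gp}`, `F` the face of elements invertible at `x`, `P_F = P + F^{gp}`
the localisation. This file does the monoid algebra for an fs monoid `P ⊆ ℤⁿ` (finitely generated,
saturated) and a face `F` (a submonoid of `P` with `a + b ∈ F ⇒ a, b ∈ F` for `a, b ∈ P`):

* `IsFaceOf` — the face property; `IsFaceOf.mem_of_nsmul_mem` — faces are saturated in `P`;
* `mem_span_int_iff_exists_sub` — `F^{gp} = F − F`; `IsFaceOf.span_inf_eq` — `F^{gp} ∩ P = F`;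
* `IsFaceOf.mem_span_of_nsmul_mem_span` — `ℤⁿ/F^{gp}` is torsion free (for saturated `P`);
* `IsFaceOf.exists_proj` — a linear projection `π : ℤⁿ → ℤⁿ` with `π(F^{gp}) = 0`,
  `v − π v ∈ F^{gp}`, `π ∘ π = π` (a splitting `ℤⁿ = F^{gp} ⊕ W`), hence
* the sharp monoid `P̄ = π(P)`: `sharp_map_proj` (`P̄ ∩ −P̄ = 0`), `map_proj_mem_sup`
  (`P̄ ⊆ P + F^{gp}`), and finite generation.

References: [Kato1994] K. Kato, Toric singularities, Amer. J. Math. 116 (1994), (1.1)–(1.6), (5.1)–(5.5), (3.2).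
-/

noncomputable section

namespace Literature.AlgebraicGeometry.Resolution

namespace LogChart

universe u

variable {n : ℕ}

/-- `F` is a **face** of the monoid `P ⊆ ℤⁿ`: a submonoid of `P` such that `a + b ∈ F` with
`a, b ∈ P` forces `a, b ∈ F` (Kato: the complement of a prime ideal of `P`, (5.1)).
[cite: Kato1994, (5.1)] -/
structure IsFaceOf (F P : AddSubmonoid (Fin n → ℤ)) : Prop where
  le : F ≤ P
  mem_of_add_mem : ∀ a ∈ P, ∀ b ∈ P, a + b ∈ F → a ∈ F

namespace IsFaceOf

variable {F P : AddSubmonoid (Fin n → ℤ)}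

/-- Symmetric form of the face property. [cite: Kato1994, (5.1)] -/
theorem mem_of_add_mem' (h : IsFaceOf F P) {a b : Fin n → ℤ} (ha : a ∈ P) (hb : b ∈ P)
    (hab : a + b ∈ F) : b ∈ F :=
  h.mem_of_add_mem b hb a ha (by rwa [add_comm])

/-- Faces are saturated in `P`: `k • v ∈ F`, `v ∈ P`, `k > 0` ⇒ `v ∈ F`. [cite: Kato1994, (5.1)] -/
theorem mem_of_nsmul_mem (h : IsFaceOf F P) {v : Fin n → ℤ} (hv : v ∈ P) {k : ℕ} (hk : 0 < k)
    (hkv : k • v ∈ F) : v ∈ F := by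
  obtain ⟨m, rfl⟩ := Nat.exists_eq_succ_of_ne_zero hk.ne'
  rw [succ_nsmul] at hkv
  exact h.mem_of_add_mem' (P.nsmul_mem hv m) hv hkv

end IsFaceOf

/-! ### The group `F^{gp} = F − F` -/

/-- The `ℤ`-span of a submonoid of an abelian group consists of the differences of its elements
(Kato (1.1): `Pᵍᵖ = {ab⁻¹ ; a, b ∈ P}`). [cite: Kato1994, (1.1)] -/
theorem mem_span_int_iff_exists_sub (F : AddSubmonoid (Fin n → ℤ)) {x : Fin n → ℤ} :
    x ∈ Submodule.span ℤ (F : Set (Fin n → ℤ)) ↔ ∃ a ∈ F, ∃ b ∈ F, x = a - b := by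
  constructor
  · intro hx
    induction hx using Submodule.span_induction with
    | mem y hy => exact ⟨y, hy, 0, F.zero_mem, (sub_zero y).symm⟩
    | zero => exact ⟨0, F.zero_mem, 0, F.zero_mem, (sub_zero 0).symm⟩
    | add y z _ _ hy hz =>
      obtain ⟨a, ha, b, hb, rfl⟩ := hy
      obtain ⟨c, hc, d, hd, rfl⟩ := hz
      exact ⟨a + c, F.add_mem ha hc, b + d, F.add_mem hb hd, by abel⟩
    | smul k y _ hy =>
      obtain ⟨a, ha, b, hb, rfl⟩ := hy
      induction k using Int.induction_on with
      | zero => exact ⟨0, F.zero_mem, 0, F.zero_mem, by simp⟩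
      | succ m _ =>
        rcases le_or_gt 0 (m : ℤ) with hm | hm
        · refine ⟨((m : ℤ) + 1).toNat • a, F.nsmul_mem ha _, ((m : ℤ) + 1).toNat • b,
            F.nsmul_mem hb _, ?_⟩
          have h1 : (((m : ℤ) + 1).toNat : ℤ) = (m : ℤ) + 1 := Int.toNat_of_nonneg (by omega)
          rw [smul_sub, ← natCast_zsmul a, ← natCast_zsmul b, h1]
        · exact absurd hm (by omega)
      | pred m _ =>
        refine ⟨((m : ℤ) + 1).toNat • b, F.nsmul_mem hb _, ((m : ℤ) + 1).toNat • a,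
          F.nsmul_mem ha _, ?_⟩
        have h1 : (((m : ℤ) + 1).toNat : ℤ) = (m : ℤ) + 1 := Int.toNat_of_nonneg (by omega)
        rw [smul_sub, ← natCast_zsmul a, ← natCast_zsmul b, h1]
        module
  · rintro ⟨a, ha, b, hb, rfl⟩
    exact Submodule.sub_mem _ (Submodule.subset_span ha) (Submodule.subset_span hb)

namespace IsFaceOf

variable {F P : AddSubmonoid (Fin n → ℤ)}

/-- `F^{gp} ∩ P = F` for a face `F` of `P`. [cite: Kato1994, (5.1)] -/
theorem mem_of_mem_span_of_mem (h : IsFaceOf F P) {v : Fin n → ℤ}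
    (hv : v ∈ Submodule.span ℤ (F : Set (Fin n → ℤ))) (hvP : v ∈ P) : v ∈ F := by
  obtain ⟨a, ha, b, hb, rfl⟩ := (mem_span_int_iff_exists_sub F).1 hv
  have hab : a - b + b = a := sub_add_cancel a b
  exact h.mem_of_add_mem _ hvP _ (h.le hb) (hab.symm ▸ ha)

/-- **`ℤⁿ/F^{gp}` is torsion free** when `P` is saturated in `ℤⁿ` and `F` is a face of `P`:
`k • v ∈ F^{gp}`, `k > 0` ⇒ `v ∈ F^{gp}`. [cite: Kato1994, (5.1)] -/
theorem mem_span_of_nsmul_mem_span (h : IsFaceOf F P)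
    (hsat : ∀ (v : Fin n → ℤ) (k : ℕ), 0 < k → k • v ∈ P → v ∈ P)
    {v : Fin n → ℤ} {k : ℕ} (hk : 0 < k)
    (hkv : k • v ∈ Submodule.span ℤ (F : Set (Fin n → ℤ))) :
    v ∈ Submodule.span ℤ (F : Set (Fin n → ℤ)) := by
  obtain ⟨a, ha, b, hb, hab⟩ := (mem_span_int_iff_exists_sub F).1 hkv
  -- `k • (v + b) = a + (k - 1) • b ∈ F ⊆ P`
  obtain ⟨m, rfl⟩ := Nat.exists_eq_succ_of_ne_zero hk.ne'
  have hkb : (m + 1) • (v + b) = a + m • b := by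
    rw [smul_add, hab, succ_nsmul]
    abel
  have hF : (m + 1) • (v + b) ∈ F := by rw [hkb]; exact F.add_mem ha (F.nsmul_mem hb m)
  have hP : v + b ∈ P := hsat _ _ (Nat.succ_pos m) (h.le hF)
  have hvb : v + b ∈ F := h.mem_of_nsmul_mem hP (Nat.succ_pos m) hF
  rw [(mem_span_int_iff_exists_sub F)]
  exact ⟨v + b, hvb, b, hb, (add_sub_cancel_right v b).symm⟩

/-! ### A splitting `ℤⁿ = F^{gp} ⊕ W` -/

/-- **Splitting off the face group.** For a face `F` of a saturated `P ⊆ ℤⁿ` there is a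
`ℤ`-linear idempotent `π : ℤⁿ → ℤⁿ` with kernel containing `F^{gp}` and `v − π v ∈ F^{gp}` for all
`v` (the quotient `ℤⁿ/F^{gp}` is torsion free, hence free, hence the projection splits).
[cite: Kato1994, (5.1)] -/
theorem exists_proj (h : IsFaceOf F P)
    (hsat : ∀ (v : Fin n → ℤ) (k : ℕ), 0 < k → k • v ∈ P → v ∈ P) :
    ∃ π : (Fin n → ℤ) →ₗ[ℤ] (Fin n → ℤ),
      (∀ v ∈ Submodule.span ℤ (F : Set (Fin n → ℤ)), π v = 0) ∧
      (∀ v, v - π v ∈ Submodule.span ℤ (F : Set (Fin n → ℤ))) ∧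
      (∀ v, π (π v) = π v) := by
  set N := Submodule.span ℤ (F : Set (Fin n → ℤ)) with hN
  -- the quotient is torsion free, hence free, hence projective
  haveI : Module.IsTorsionFree ℤ ((Fin n → ℤ) ⧸ N) := by
    refine Module.IsTorsionFree.of_smul_eq_zero fun k x hkx => ?_
    by_cases hk : k = 0
    · exact Or.inl hk
    right
    obtain ⟨v, rfl⟩ := Submodule.mkQ_surjective N x
    rw [← map_zsmul, Submodule.mkQ_apply, Submodule.Quotient.mk_eq_zero] at hkx
    rw [Submodule.mkQ_apply, Submodule.Quotient.mk_eq_zero]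
    have hk' : 0 < k.natAbs := Int.natAbs_pos.2 hk
    refine h.mem_span_of_nsmul_mem_span hsat hk' ?_
    rcases Int.natAbs_eq k with hk1 | hk1
    · rw [← natCast_zsmul, ← hk1]; exact hkx
    · rw [← natCast_zsmul, show ((k.natAbs : ℕ) : ℤ) = -k by omega, neg_smul]
      exact N.neg_mem hkx
  haveI : Module.Finite ℤ ((Fin n → ℤ) ⧸ N) := Module.Finite.quotient ℤ N
  haveI hfree : Module.Free ℤ ((Fin n → ℤ) ⧸ N) := Module.free_of_finite_type_torsion_free'
  -- a section of `mkQ` from a basis of the free quotient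
  obtain ⟨s, hs⟩ : ∃ s : ((Fin n → ℤ) ⧸ N) →ₗ[ℤ] (Fin n → ℤ), N.mkQ ∘ₗ s = LinearMap.id := by
    let b := Module.Free.chooseBasis ℤ ((Fin n → ℤ) ⧸ N)
    choose lift hlift using fun i => Submodule.mkQ_surjective N (b i)
    refine ⟨b.constr ℤ lift, b.ext fun i => ?_⟩
    show N.mkQ (b.constr ℤ lift (b i)) = b i
    rw [Module.Basis.constr_basis]
    exact hlift i
  have hsv : ∀ x, N.mkQ (s x) = x := fun x => LinearMap.congr_fun hs x
  refine ⟨s ∘ₗ N.mkQ, fun v hv => ?_, fun v => ?_, fun v => ?_⟩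
  · have h0 : N.mkQ v = 0 := (Submodule.Quotient.mk_eq_zero N).2 hv
    exact (congrArg s h0).trans (map_zero s)
  · have h1 : N.mkQ (v - s (N.mkQ v)) = 0 := by rw [map_sub, hsv, sub_self]
    exact (Submodule.Quotient.mk_eq_zero N).1 h1
  · exact congrArg s (hsv _)

/-! ### The sharp monoid `P̄ = π(P)` -/

/-- `π v ∈ F^{gp}` forces `π v = 0`. [cite: Kato1994, (5.1)] -/
theorem proj_eq_zero_of_mem_span {π : (Fin n → ℤ) →ₗ[ℤ] (Fin n → ℤ)}
    (hπ0 : ∀ v ∈ Submodule.span ℤ (F : Set (Fin n → ℤ)), π v = 0)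
    (hπ2 : ∀ v, π (π v) = π v) {v : Fin n → ℤ}
    (hv : π v ∈ Submodule.span ℤ (F : Set (Fin n → ℤ))) : π v = 0 := by
  rw [← hπ2 v]; exact hπ0 _ hv

/-- **`P̄ = π(P)` lies in the localisation `P + F^{gp}`.** [cite: Kato1994, (5.1)] -/
theorem map_proj_mem_sup {π : (Fin n → ℤ) →ₗ[ℤ] (Fin n → ℤ)}
    (hπ1 : ∀ v, v - π v ∈ Submodule.span ℤ (F : Set (Fin n → ℤ))) (p : Fin n → ℤ) :
    ∃ f ∈ Submodule.span ℤ (F : Set (Fin n → ℤ)), π p = p - f :=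
  ⟨p - π p, hπ1 p, (sub_sub_cancel p (π p)).symm⟩

/-- **`P̄ = π(P)` is sharp**: if `w` and `−w` both lie in `π(P)` then `w = 0` (the units of
`P + F^{gp}` are exactly `F^{gp}`). [cite: Kato1994, (5.1)] -/
theorem sharp_map_proj (h : IsFaceOf F P) {π : (Fin n → ℤ) →ₗ[ℤ] (Fin n → ℤ)}
    (hπ0 : ∀ v ∈ Submodule.span ℤ (F : Set (Fin n → ℤ)), π v = 0)
    (hπ1 : ∀ v, v - π v ∈ Submodule.span ℤ (F : Set (Fin n → ℤ)))
    {p p' : Fin n → ℤ} (hp : p ∈ P) (hp' : p' ∈ P)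
    (hsum : π p + π p' = 0) : π p = 0 := by
  -- `p + p' ∈ F^{gp} ∩ P = F`, so `p, p' ∈ F` and `π p = 0`
  have h1 : p + p' ∈ Submodule.span ℤ (F : Set (Fin n → ℤ)) := by
    have h2 := hπ1 (p + p')
    rw [map_add, hsum, sub_zero] at h2
    exact h2
  have hF : p + p' ∈ F := h.mem_of_mem_span_of_mem h1 (P.add_mem hp hp')
  exact hπ0 p (Submodule.subset_span (h.mem_of_add_mem p hp p' hp' hF))

/-- The projection of `p ∈ P` vanishes iff `p ∈ F`. [cite: Kato1994, (5.1)] -/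
theorem proj_eq_zero_iff (h : IsFaceOf F P) {π : (Fin n → ℤ) →ₗ[ℤ] (Fin n → ℤ)}
    (hπ0 : ∀ v ∈ Submodule.span ℤ (F : Set (Fin n → ℤ)), π v = 0)
    (hπ1 : ∀ v, v - π v ∈ Submodule.span ℤ (F : Set (Fin n → ℤ))) {p : Fin n → ℤ} (hp : p ∈ P) :
    π p = 0 ↔ p ∈ F := by
  constructor
  · intro h0
    have h1 := hπ1 p
    rw [h0, sub_zero] at h1
    exact h.mem_of_mem_span_of_mem h1 hp
  · intro hpF
    exact hπ0 p (Submodule.subset_span hpF)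

/-- `π(P)` is finitely generated when `P` is. [cite: Kato1994, (5.1)] -/
theorem map_proj_fg {π : (Fin n → ℤ) →ₗ[ℤ] (Fin n → ℤ)} (hP : P.FG) :
    (P.map π.toAddMonoidHom).FG :=
  hP.map _

end IsFaceOf

end LogChart

end Literature.AlgebraicGeometry.Resolution
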